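import Summits.Parity.GeneralizedHardyLittlewood.Theorems.PrimeLevelFamEdgeIdeaDeltasNegationRoguePreserve
import HarnessLib

/-!
# Route `PrimeLevelFamEdge` — TYPED IDEA DELTAS, deck 14h: K-L20-3 «THE ROGUE FORM», part 5 — PRESERVED below the
# diagonal (`momentAsymptoticsFam_rogue_below_one`: every display with `0 ≤ Δlo ≤ Δhi < 1`, ANY level-free pair), the
# packaged INDEPENDENCE CERTIFICATE `independence` / `independence_true` (under the printed facts of record `kmv2000_eq4`,
# `kowalskiMichel2000_peterssonBound`, `bettin2017_theorem11_primeLevel`, `kmv2000_firstMomentPQ`, `kmv2000_secondMomentPQ`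
# as HYPOTHESES: the true family models the constraints of record and its rogue extension models them with the transported
# K_A FALSE), and obstructions (O1) violated by the rogue / (O2) `WeightFloorFam` (§6b second half, §7).  Seat ls-idea-lens-20
# gen 2, `Sketch_L20c_RogueForm.lean` v10 sha16 64d60d2997a1fa36 l.1072–1324 + l.1414–1460 VERBATIM up to the namespace
# relabel (typer ls-idea-typ-1 gen 3); critic E b8 PASS as INDEPENDENCE CERTIFICATE + LEDGER (typed method floor = the
# diagonal for the constraints of record).  READING (value-neutral): no argument using the family only through {positivity,
# mass, KM-type Petersson BOUND, Bettin's first twisted moment, KMV's laws below the diagonal} proves K_A.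
HONESTY: everything here is about TABLES (axiomatised families), which cannot instantiate `KMV2000.MomentAsymptotics`
(REF-E (E5)); nothing proves K_A (stmt-Parity-20007), K_B, any moment asymptotic or any exceptional-zero theorem (no
Landau–Siegel / Siegel-zero exclusion, no Theorem 1–2 of arXiv:2211.02515, no repaired Margin232); typed ≠ proved.
-/

noncomputable section

open scoped Real
open Finset Complex Polynomial CongruenceSubgroup
open Literature.NumberTheory.LFunctions
open Literature.NumberTheory.LFunctions.KMV2000
open Literature.NumberTheory.EllipticCurves.ModularForms

namespace Summit.Parity.GeneralizedHardyLittlewood.Theorems.PrimeLevelFamEdgeIdeaDeltas.Negation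

universe u

variable {α : Type u}
variable {β : ℕ → Type u}

/-- PRESERVED: the transported displays BELOW THE DIAGONAL (`0 ≤ Δlo`, `Δhi < 1`; any level-free
`(T₁, T₂)`, in particular KMV's diagonal-only law `T₁ = T₂ = 0` of `momentAsymptoticsDiagOnly_of_kmv`). -/
theorem momentAsymptoticsFam_rogue_below_one (𝓕 : Tables β) {Δlo Δhi : ℝ} (hlo : 0 ≤ Δlo)
    (hhi : Δhi < 1) (T₁ T₂ : ℝ → ℝ[X] → ℝ[X] → ℝ) (h : MomentAsymptoticsFam 𝓕 Δlo Δhi T₁ T₂) :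
    MomentAsymptoticsFam (rogueTables 𝓕) Δlo Δhi T₁ T₂ := by
  intro P Q hP hQ Δ hΔlo hΔhi
  obtain ⟨C, q₀, hC⟩ := h P Q hP hQ Δ hΔlo hΔhi
  have hΔpos : 0 < Δ := lt_of_le_of_lt hlo hΔlo
  have hΔ1 : Δ < 1 := lt_of_le_of_lt hΔhi hhi
  obtain ⟨ε, hε_def⟩ : ∃ ε : ℝ, ε = (1 - Δ) / 3 := ⟨_, rfl⟩
  obtain ⟨ε', hε'_def⟩ : ∃ ε' : ℝ, ε' = (1 - Δ / 2) / 2 := ⟨_, rfl⟩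
  have hε : 0 < ε := by rw [hε_def]; linarith
  have hε' : 0 < ε' := by rw [hε'_def]; linarith
  obtain ⟨B, hB_def⟩ : ∃ B : ℝ, B = coeffBound P := ⟨_, rfl⟩
  have hB0 : 0 ≤ B := by rw [hB_def]; exact coeffBound_nonneg P
  obtain ⟨a₀, ha₀_def⟩ : ∃ a₀ : ℝ, a₀ = |Q.coeff 0| := ⟨_, rfl⟩
  have ha₀ : 0 ≤ a₀ := by rw [ha₀_def]; exact abs_nonneg _
  obtain ⟨K₁, hK₁_def⟩ : ∃ K₁ : ℝ, K₁ = 2 * a₀ * B / ε' ^ 2 := ⟨_, rfl⟩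
  obtain ⟨K₂, hK₂_def⟩ : ∃ K₂ : ℝ, K₂ = 2 / Real.pi * a₀ ^ 2 * B ^ 2 / ε ^ 3 := ⟨_, rfl⟩
  have hK₁ : 0 ≤ K₁ := by rw [hK₁_def]; positivity
  have hK₂ : 0 ≤ K₂ := by rw [hK₂_def]; positivity
  refine ⟨C + K₁ + K₂, max q₀ 40, fun q _ hq hq₀ hgoodM ↦ ?_⟩
  have hq₀' : q₀ ≤ q := le_trans (le_max_left _ _) hq₀
  have hq40 : 40 ≤ q := le_trans (le_max_right _ _) hq₀
  obtain ⟨h1, h2⟩ := hC q hq hq₀' hgoodM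
  have hqhat1 : 1 < qhat q := one_lt_qhat hq40
  have hqhatpos : 0 < qhat q := by linarith
  have hLpos : 0 < Real.log (qhat q) := Real.log_pos hqhat1
  have hqpos : (0 : ℝ) < q := by exact_mod_cast (by omega : 0 < q)
  obtain ⟨M, hM_def⟩ : ∃ M : ℝ, M = qhat q ^ Δ := ⟨_, rfl⟩
  rw [← hM_def] at h1 h2 ⊢
  have hMpos : 0 < M := by rw [hM_def]; exact Real.rpow_pos_of_pos hqhatpos _
  obtain ⟨S, hS_def⟩ : ∃ S : ℝ, S = rogueMollSum P M := ⟨_, rfl⟩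
  have hS : |S| ≤ B * (2 * Real.sqrt M) := by
    rw [hS_def, hB_def]; exact abs_rogueMollSum_le P hMpos.le
  have hsqrtM : Real.sqrt M = qhat q ^ (Δ / 2) := by
    rw [hM_def, Real.sqrt_eq_rpow, ← Real.rpow_mul hqhatpos.le]
    congr 1
    ring
  rw [hsqrtM] at hS
  -- `ε log q̂ ≤ q̂^ε`, cubed and squared
  have hlogε : ε * Real.log (qhat q) ≤ qhat q ^ ε := by
    have := Real.log_le_rpow_div hqhatpos.le hε
    rwa [le_div_iff₀ hε, mul_comm] at this
  have hlogε' : ε' * Real.log (qhat q) ≤ qhat q ^ ε' := by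
    have := Real.log_le_rpow_div hqhatpos.le hε'
    rwa [le_div_iff₀ hε', mul_comm] at this
  have hlog3 : (ε * Real.log (qhat q)) ^ 3 ≤ qhat q ^ (1 - Δ) := by
    have h3 := pow_le_pow_left₀ (by positivity) hlogε 3
    have : (qhat q ^ ε) ^ 3 = qhat q ^ (1 - Δ) := by
      rw [← Real.rpow_natCast, ← Real.rpow_mul hqhatpos.le, hε_def]
      congr 1
      push_cast
      ring
    rwa [this] at h3
  have hlog2 : (ε' * Real.log (qhat q)) ^ 2 ≤ qhat q ^ (1 - Δ / 2) := by
    have h3 := pow_le_pow_left₀ (by positivity) hlogε' 2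
    have : (qhat q ^ ε') ^ 2 = qhat q ^ (1 - Δ / 2) := by
      rw [← Real.rpow_natCast, ← Real.rpow_mul hqhatpos.le, hε'_def]
      congr 1
      push_cast
      ring
    rwa [this] at h3
  have h3pos : 0 < (ε * Real.log (qhat q)) ^ 3 := by positivity
  have h2pos : 0 < (ε' * Real.log (qhat q)) ^ 2 := by positivity
  rw [rogueTables_apply]
  -- norms of the rogue pieces
  have hjet : ‖rogueJet q 0‖ = Real.sqrt (qhat q) * Real.sqrt q := by
    rw [rogueJet_zero, Complex.norm_real, Real.norm_eq_abs, abs_of_nonneg (by positivity)]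
  have hw : 0 ≤ rogueW q := by unfold rogueW; positivity
  have hwq : rogueW q * Real.sqrt q = (q : ℝ)⁻¹ := by
    unfold rogueW
    rw [Real.sqrt_eq_rpow, ← Real.rpow_add hqpos, ← Real.rpow_neg_one]
    norm_num
  have hqinv : (q : ℝ)⁻¹ ≤ (qhat q)⁻¹ := inv_anti₀ hqhatpos (qhat_le_self (by omega))
  constructor
  · -- FIRST DISPLAY
    rw [LhF_rogue, ← hS_def]
    have hextra : ‖(rogueW q : ℂ) * ((Q.coeff 0 : ℂ) * rogueJet q 0 * ((S : ℝ) : ℂ))‖ ≤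
        K₁ * Real.sqrt (qhat q) * (Real.log (qhat q))⁻¹ ^ 2 := by
      rw [norm_mul, norm_mul, norm_mul, Complex.norm_real, Complex.norm_real, Complex.norm_real,
        hjet, Real.norm_eq_abs, Real.norm_eq_abs, Real.norm_eq_abs, abs_of_nonneg hw, ← ha₀_def]
      -- = a₀ √q̂ |S| (w* √q) ≤ a₀ √q̂ |S| q̂⁻¹
      have step1 : rogueW q * (a₀ * (Real.sqrt (qhat q) * Real.sqrt q) * |S|) ≤
          a₀ * Real.sqrt (qhat q) * (qhat q)⁻¹ * (B * (2 * qhat q ^ (Δ / 2))) := by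
        calc rogueW q * (a₀ * (Real.sqrt (qhat q) * Real.sqrt q) * |S|)
            = a₀ * Real.sqrt (qhat q) * (rogueW q * Real.sqrt q) * |S| := by ring
          _ = a₀ * Real.sqrt (qhat q) * (q : ℝ)⁻¹ * |S| := by rw [hwq]
          _ ≤ a₀ * Real.sqrt (qhat q) * (qhat q)⁻¹ * (B * (2 * qhat q ^ (Δ / 2))) := by
              apply mul_le_mul _ hS (abs_nonneg _) (by positivity)
              exact mul_le_mul_of_nonneg_left hqinv (by positivity)
      refine step1.trans ?_
      -- q̂⁻¹ q̂^{Δ/2} (ε' log)² ≤ q̂⁻¹ q̂^{Δ/2} q̂^{1-Δ/2} = 1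
      have hone : (qhat q)⁻¹ * qhat q ^ (Δ / 2) * qhat q ^ (1 - Δ / 2) = 1 := by
        rw [mul_assoc, ← Real.rpow_add hqhatpos, show Δ / 2 + (1 - Δ / 2) = (1 : ℝ) by ring,
          Real.rpow_one, inv_mul_cancel₀ hqhatpos.ne']
      have hkey : (qhat q)⁻¹ * qhat q ^ (Δ / 2) * (ε' * Real.log (qhat q)) ^ 2 ≤ 1 :=
        calc (qhat q)⁻¹ * qhat q ^ (Δ / 2) * (ε' * Real.log (qhat q)) ^ 2
            ≤ (qhat q)⁻¹ * qhat q ^ (Δ / 2) * qhat q ^ (1 - Δ / 2) :=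
              mul_le_mul_of_nonneg_left hlog2 (by positivity)
          _ = 1 := hone
      have hshape : K₁ * Real.sqrt (qhat q) * (Real.log (qhat q))⁻¹ ^ 2 =
          2 * a₀ * B * Real.sqrt (qhat q) / (ε' * Real.log (qhat q)) ^ 2 := by
        rw [hK₁_def]
        field_simp
      rw [hshape, le_div_iff₀ h2pos]
      calc a₀ * Real.sqrt (qhat q) * (qhat q)⁻¹ * (B * (2 * qhat q ^ (Δ / 2))) *
            (ε' * Real.log (qhat q)) ^ 2
          = 2 * a₀ * B * Real.sqrt (qhat q) *
              ((qhat q)⁻¹ * qhat q ^ (Δ / 2) * (ε' * Real.log (qhat q)) ^ 2) := by ring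
        _ ≤ 2 * a₀ * B * Real.sqrt (qhat q) * 1 :=
            mul_le_mul_of_nonneg_left hkey (by positivity)
        _ = 2 * a₀ * B * Real.sqrt (qhat q) := by ring
    have hrest : 0 ≤ K₂ * Real.sqrt (qhat q) * (Real.log (qhat q))⁻¹ ^ 2 := by positivity
    calc ‖(rogueW q : ℂ) * ((Q.coeff 0 : ℂ) * rogueJet q 0 * ((S : ℝ) : ℂ)) + LhF q (𝓕 q) P Q M -
          riemannZeta 2 * ((Real.sqrt (qhat q) / (Δ * Real.log (qhat q)) : ℝ) : ℂ) *
            ((KMV2000.linForm Δ P Q + T₁ Δ P Q : ℝ) : ℂ)‖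
        = ‖(LhF q (𝓕 q) P Q M -
            riemannZeta 2 * ((Real.sqrt (qhat q) / (Δ * Real.log (qhat q)) : ℝ) : ℂ) *
              ((KMV2000.linForm Δ P Q + T₁ Δ P Q : ℝ) : ℂ)) +
            (rogueW q : ℂ) * ((Q.coeff 0 : ℂ) * rogueJet q 0 * ((S : ℝ) : ℂ))‖ := by ring_nf
      _ ≤ ‖LhF q (𝓕 q) P Q M -
            riemannZeta 2 * ((Real.sqrt (qhat q) / (Δ * Real.log (qhat q)) : ℝ) : ℂ) *
              ((KMV2000.linForm Δ P Q + T₁ Δ P Q : ℝ) : ℂ)‖ +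
            ‖(rogueW q : ℂ) * ((Q.coeff 0 : ℂ) * rogueJet q 0 * ((S : ℝ) : ℂ))‖ := norm_add_le _ _
      _ ≤ C * Real.sqrt (qhat q) * (Real.log (qhat q))⁻¹ ^ 2 +
            K₁ * Real.sqrt (qhat q) * (Real.log (qhat q))⁻¹ ^ 2 := add_le_add h1 hextra
      _ ≤ (C + K₁ + K₂) * Real.sqrt (qhat q) * (Real.log (qhat q))⁻¹ ^ 2 := by
          rw [show (C + K₁ + K₂) * Real.sqrt (qhat q) * (Real.log (qhat q))⁻¹ ^ 2 =
            (C * Real.sqrt (qhat q) * (Real.log (qhat q))⁻¹ ^ 2 +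
              K₁ * Real.sqrt (qhat q) * (Real.log (qhat q))⁻¹ ^ 2) +
              K₂ * Real.sqrt (qhat q) * (Real.log (qhat q))⁻¹ ^ 2 by ring]
          linarith
  · -- SECOND DISPLAY
    rw [QhF_rogue, ← hS_def]
    have hextra : ‖(rogueW q : ℂ) *
        (((‖(Q.coeff 0 : ℂ) * rogueJet q 0 * ((S : ℝ) : ℂ)‖ ^ 2 : ℝ) : ℂ))‖ ≤
        K₂ * qhat q * (Real.log (qhat q))⁻¹ ^ 3 := by
      rw [norm_mul, Complex.norm_real, Complex.norm_real, Real.norm_eq_abs, abs_of_nonneg hw,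
        Real.norm_eq_abs, abs_of_nonneg (sq_nonneg _), norm_mul, norm_mul, Complex.norm_real,
        Complex.norm_real, Real.norm_eq_abs, ← ha₀_def, Real.norm_eq_abs]
      -- = a₀² S² (w* ‖jet‖²) = a₀² S² /(2π)
      have hid : rogueW q * (a₀ * ‖rogueJet q 0‖ * |S|) ^ 2 =
          a₀ ^ 2 * S ^ 2 * (rogueW q * ‖rogueJet q 0‖ ^ 2) := by rw [mul_pow, mul_pow, sq_abs]; ring
      rw [hid, rogueW_mul_norm_jet_sq]
      have hS2 : S ^ 2 ≤ (B * (2 * qhat q ^ (Δ / 2))) ^ 2 := by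
        rw [← sq_abs S]
        exact pow_le_pow_left₀ (abs_nonneg S) hS 2
      have hM' : (qhat q ^ (Δ / 2)) ^ 2 = M := by
        rw [hM_def, ← Real.rpow_natCast, ← Real.rpow_mul hqhatpos.le]
        congr 1
        push_cast
        ring
      have hS2' : S ^ 2 ≤ 4 * B ^ 2 * M := by
        calc S ^ 2 ≤ (B * (2 * qhat q ^ (Δ / 2))) ^ 2 := hS2
          _ = 4 * B ^ 2 * (qhat q ^ (Δ / 2)) ^ 2 := by ring
          _ = 4 * B ^ 2 * M := by rw [hM']
      -- M (ε log)³ ≤ M q̂^{1-Δ} = q̂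
      have hone : M * qhat q ^ (1 - Δ) = qhat q := by
        rw [hM_def, ← Real.rpow_add hqhatpos, show Δ + (1 - Δ) = (1 : ℝ) by ring, Real.rpow_one]
      have hkey : M * (ε * Real.log (qhat q)) ^ 3 ≤ qhat q :=
        calc M * (ε * Real.log (qhat q)) ^ 3 ≤ M * qhat q ^ (1 - Δ) :=
              mul_le_mul_of_nonneg_left hlog3 hMpos.le
          _ = qhat q := hone
      have hshape : K₂ * qhat q * (Real.log (qhat q))⁻¹ ^ 3 =
          2 / Real.pi * a₀ ^ 2 * B ^ 2 * qhat q / (ε * Real.log (qhat q)) ^ 3 := by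
        rw [hK₂_def]
        field_simp
      rw [hshape, le_div_iff₀ h3pos]
      have hπ : 0 < Real.pi := Real.pi_pos
      calc a₀ ^ 2 * S ^ 2 * (1 / (2 * Real.pi)) * (ε * Real.log (qhat q)) ^ 3
          ≤ a₀ ^ 2 * (4 * B ^ 2 * M) * (1 / (2 * Real.pi)) * (ε * Real.log (qhat q)) ^ 3 := by
            gcongr
        _ = 2 / Real.pi * a₀ ^ 2 * B ^ 2 * (M * (ε * Real.log (qhat q)) ^ 3) := by
            field_simp
            ring
        _ ≤ 2 / Real.pi * a₀ ^ 2 * B ^ 2 * qhat q :=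
            mul_le_mul_of_nonneg_left hkey (by positivity)
    have hrest : 0 ≤ K₁ * qhat q * (Real.log (qhat q))⁻¹ ^ 3 := by positivity
    calc ‖(rogueW q : ℂ) * (((‖(Q.coeff 0 : ℂ) * rogueJet q 0 * ((S : ℝ) : ℂ)‖ ^ 2 : ℝ) : ℂ)) +
          QhF q (𝓕 q) P Q M -
          2 * riemannZeta 2 ^ 2 * ((qhat q / (Δ ^ 2 * Real.log (qhat q) ^ 2) : ℝ) : ℂ) *
            ((KMV2000.secondMomentForm Δ P Q + T₂ Δ P Q : ℝ) : ℂ)‖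
        = ‖(QhF q (𝓕 q) P Q M -
            2 * riemannZeta 2 ^ 2 * ((qhat q / (Δ ^ 2 * Real.log (qhat q) ^ 2) : ℝ) : ℂ) *
              ((KMV2000.secondMomentForm Δ P Q + T₂ Δ P Q : ℝ) : ℂ)) +
            (rogueW q : ℂ) * (((‖(Q.coeff 0 : ℂ) * rogueJet q 0 * ((S : ℝ) : ℂ)‖ ^ 2 : ℝ) : ℂ))‖ := by
          ring_nf
      _ ≤ ‖QhF q (𝓕 q) P Q M -
            2 * riemannZeta 2 ^ 2 * ((qhat q / (Δ ^ 2 * Real.log (qhat q) ^ 2) : ℝ) : ℂ) *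
              ((KMV2000.secondMomentForm Δ P Q + T₂ Δ P Q : ℝ) : ℂ)‖ +
            ‖(rogueW q : ℂ) * (((‖(Q.coeff 0 : ℂ) * rogueJet q 0 * ((S : ℝ) : ℂ)‖ ^ 2 : ℝ) : ℂ))‖ :=
          norm_add_le _ _
      _ ≤ C * qhat q * (Real.log (qhat q))⁻¹ ^ 3 + K₂ * qhat q * (Real.log (qhat q))⁻¹ ^ 3 :=
          add_le_add h2 hextra
      _ ≤ (C + K₁ + K₂) * qhat q * (Real.log (qhat q))⁻¹ ^ 3 := by
          rw [show (C + K₁ + K₂) * qhat q * (Real.log (qhat q))⁻¹ ^ 3 =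
            (C * qhat q * (Real.log (qhat q))⁻¹ ^ 3 + K₂ * qhat q * (Real.log (qhat q))⁻¹ ^ 3) +
              K₁ * qhat q * (Real.log (qhat q))⁻¹ ^ 3 by ring]
          linarith

/-- COROLLARY: KMV's diagonal-only law (`T₁ = T₂ = 0`, `0 ≤ Δlo`, `Δhi < 1`) transported to the
true family and PROVED there from the two printed KMV facts survives the rogue extension. -/
theorem momentAsymptoticsFam_rogue_true_diagOnly (h₁ : kmv2000_firstMomentPQ)
    (h₂ : kmv2000_secondMomentPQ) {Δlo Δhi : ℝ} (hlo : 0 ≤ Δlo) (hhi : Δhi < 1) :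
    MomentAsymptoticsFam (rogueTables trueTables) Δlo Δhi (fun _ _ _ ↦ 0) (fun _ _ _ ↦ 0) := by
  have h : MomentAsymptotics Δlo Δhi (fun _ _ _ ↦ 0) (fun _ _ _ ↦ 0) :=
    momentAsymptoticsDiagOnly_of_kmv h₁ h₂ hlo hhi
  rw [← momentAsymptoticsFam_true_iff] at h
  exact momentAsymptoticsFam_rogue_below_one trueTables hlo hhi _ _ h

/-! ## §7. INDEPENDENCE packaged, and the typed OBSTRUCTIONS met on the way -/

/-- The transported CONSTRAINTS OF RECORD on a family of tables (REF-E (E5)'s list + mass):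
non-negative weights, harmonic mass, the KM Petersson bound, Bettin's first moment, and every
display below the diagonal for the given level-free pair. -/
def ConstraintsOfRecord (𝓕 : Tables β) (T₁ T₂ : ℝ → ℝ[X] → ℝ[X] → ℝ) : Prop :=
  NonnegFam 𝓕 ∧ MassFam 𝓕 ∧ PeterssonBoundFam 𝓕 ∧ BettinFam 𝓕 ∧
    ∀ Δlo Δhi : ℝ, 0 ≤ Δlo → Δhi < 1 → MomentAsymptoticsFam 𝓕 Δlo Δhi T₁ T₂

/-- The constraints of record pass to the rogue extension. -/
theorem constraintsOfRecord_rogue (𝓕 : Tables β) (T₁ T₂ : ℝ → ℝ[X] → ℝ[X] → ℝ)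
    (h : ConstraintsOfRecord 𝓕 T₁ T₂) : ConstraintsOfRecord (rogueTables 𝓕) T₁ T₂ :=
  ⟨nonnegFam_rogue 𝓕 h.1, massFam_rogue 𝓕 h.2.1, peterssonBoundFam_rogue 𝓕 h.2.2.1,
    bettinFam_rogue 𝓕 h.2.2.2.1,
    fun Δlo Δhi hlo hhi ↦ momentAsymptoticsFam_rogue_below_one 𝓕 hlo hhi T₁ T₂ (h.2.2.2.2 Δlo Δhi hlo hhi)⟩

/-- **INDEPENDENCE (table world).** Any family of tables meeting the constraints of record
extends to one meeting them and violating the transported K_A: the constraints of record do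
not imply K_A^F. -/
theorem independence (𝓕 : Tables β) (T₁ T₂ : ℝ → ℝ[X] → ℝ[X] → ℝ)
    (h : ConstraintsOfRecord 𝓕 T₁ T₂) :
    ∃ 𝓖 : Tables (fun q ↦ Option (β q)), ConstraintsOfRecord 𝓖 T₁ T₂ ∧ ¬ MomentsBeyondDiagonalFam 𝓖 :=
  ⟨rogueTables 𝓕, constraintsOfRecord_rogue 𝓕 T₁ T₂ h, not_momentsBeyondDiagonalFam_rogue 𝓕 h.1⟩

/-- **INDEPENDENCE (anchored at the true family).** Under the PRINTED facts of record
(`kmv2000_eq4`, the KM Petersson bound, Bettin's Theorem 1.1 at prime level, KMV Props. 4.1/5.1)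
the true family is a model of the constraints of record (diagonal-only pair), and its rogue
extension is a model of the same constraints in which the transported K_A FAILS. Nothing is
claimed about `MomentsBeyondDiagonal` itself (which quantifies over `S₂(q)*`, not over tables). -/
theorem independence_true (h4 : kmv2000_eq4) (hKM : KowalskiMichel2000.kowalskiMichel2000_peterssonBound)
    (hB : bettin2017_theorem11_primeLevel) (h₁ : kmv2000_firstMomentPQ) (h₂ : kmv2000_secondMomentPQ) :
    ConstraintsOfRecord trueTables (fun _ _ _ ↦ 0) (fun _ _ _ ↦ 0) ∧
    ∃ 𝓖 : Tables (fun q ↦ Option (CuspForm (Gamma0 q) 2)),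
      ConstraintsOfRecord 𝓖 (fun _ _ _ ↦ 0) (fun _ _ _ ↦ 0) ∧ ¬ MomentsBeyondDiagonalFam 𝓖 := by
  have hT : ConstraintsOfRecord trueTables (fun _ _ _ ↦ 0) (fun _ _ _ ↦ 0) := by
    refine ⟨nonnegFam_true, massFam_true_iff.mpr h4, peterssonBoundFam_true_iff.mpr hKM,
      bettinFam_true_iff.mpr hB, fun Δlo Δhi hlo hhi ↦ ?_⟩
    have h : MomentAsymptotics Δlo Δhi (fun _ _ _ ↦ 0) (fun _ _ _ ↦ 0) :=
      momentAsymptoticsDiagOnly_of_kmv h₁ h₂ hlo hhi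
    rwa [← momentAsymptoticsFam_true_iff] at h
  exact ⟨hT, independence trueTables _ _ hT⟩


/-- The rogue violates (O1) at every `Δ' > 1` — this is the content of §5, repackaged. -/
theorem not_singleFormBound_rogue (𝓕 : Tables β) (h𝓕 : NonnegFam 𝓕) {Δ : ℝ} (hΔ : 1 < Δ)
    (T₁ T₂ : ℝ → ℝ[X] → ℝ[X] → ℝ) :
    ¬ (MomentAsymptoticsFam (rogueTables 𝓕) 1 Δ T₁ T₂ ∧
        ∀ Δ' : ℝ, 1 < Δ' → Δ' ≤ Δ → SingleFormBoundFam (rogueTables 𝓕) Δ') :=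
  fun h ↦ not_momentAsymptoticsFam_rogue 𝓕 h𝓕 hΔ T₁ T₂ h.1

/-- (O2) A WEIGHT FLOOR of exponent `κ`: `w_f ≥ c · q^{-κ}` on the whole index set, eventually
(Goldfeld–Hoffstein–Lieman give `κ = 1 + ε` for `S₂(q)*`). -/
def WeightFloorFam (𝓕 : Tables β) (κ : ℝ) : Prop :=
  ∃ c : ℝ, 0 < c ∧ ∃ q₀ : ℕ, ∀ (q : ℕ) [NeZero q], q.Prime → q₀ ≤ q →
    ∀ f ∈ (𝓕 q).S, c * (q : ℝ) ^ (-κ) ≤ (𝓕 q).w f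

/-- The rogue family violates EVERY weight floor of exponent `κ < 3/2`: its weight `q^{-3/2}` is
sub-physical — and `q^{-3/2}` is forced by the tolerances of `kmv2000_eq4`/Petersson at `(1,1)`. -/
theorem not_weightFloorFam_rogue (𝓕 : Tables β) {κ : ℝ} (hκ : κ < 3 / 2) :
    ¬ WeightFloorFam (rogueTables 𝓕) κ := by
  rintro ⟨c, hc, q₀, h⟩
  have he : 0 < 3 / 2 - κ := by linarith
  obtain ⟨N, hN⟩ := exists_nat_gt ((1 / c) ^ (3 / 2 - κ)⁻¹)
  obtain ⟨q, hqge, hqprime⟩ := Nat.exists_infinite_primes (max q₀ (N + 1))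
  haveI : NeZero q := ⟨hqprime.ne_zero⟩
  have hq₀ : q₀ ≤ q := le_trans (le_max_left _ _) hqge
  have hqN : N + 1 ≤ q := le_trans (le_max_right _ _) hqge
  have hqpos : (0 : ℝ) < q := by exact_mod_cast hqprime.pos
  have hmem : (none : Option (β q)) ∈ (rogueTables 𝓕 q).S := by
    simp [rogueTables, rogue]
  have hw := h q hqprime hq₀ none hmem
  have hw' : c * (q : ℝ) ^ (-κ) ≤ (q : ℝ) ^ (-(3 / 2 : ℝ)) := hw
  -- so `c ≤ q^{κ - 3/2} = (q^{3/2-κ})⁻¹ < c`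
  have hc_le : c ≤ ((q : ℝ) ^ (3 / 2 - κ))⁻¹ := by
    have hmul := mul_le_mul_of_nonneg_right hw' (Real.rpow_nonneg hqpos.le κ)
    rw [mul_assoc, ← Real.rpow_add hqpos, ← Real.rpow_add hqpos, neg_add_cancel, Real.rpow_zero,
      mul_one] at hmul
    rwa [← Real.rpow_neg hqpos.le, show -(3 / 2 - κ) = -(3 / 2 : ℝ) + κ by ring]
  have hbig : 1 / c < (q : ℝ) ^ (3 / 2 - κ) := by
    have hN' : (1 / c) ^ (3 / 2 - κ)⁻¹ < q := by
      refine hN.trans ?_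
      exact_mod_cast (by omega : N < q)
    have h0 : 0 ≤ (1 / c) ^ (3 / 2 - κ)⁻¹ := Real.rpow_nonneg (by positivity) _
    have := Real.rpow_lt_rpow h0 hN' he
    rwa [Real.rpow_inv_rpow (by positivity) he.ne'] at this
  have hpow_pos : 0 < (q : ℝ) ^ (3 / 2 - κ) := Real.rpow_pos_of_pos hqpos _
  have : ((q : ℝ) ^ (3 / 2 - κ))⁻¹ < c := by
    rw [inv_lt_comm₀ hpow_pos hc]
    rwa [one_div] at hbig
  linarith

end Summit.Parity.GeneralizedHardyLittlewood.Theorems.PrimeLevelFamEdgeIdeaDeltas.Negation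

end
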